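import Summits.CriticalPhenomena.PercolationContinuityZ3.Theorems.PercNearOneGluingNoHeavyQuantCerfZoneZ3
import Summits.CriticalPhenomena.PercolationContinuityZ3.Theorems.PercNearOneGluingNoHeavyQuantTwoPointPowerLawFreeEpsModulus
import Summits.CriticalPhenomena.PercolationContinuityZ3.Theorems.PercNearOneGluingNoHeavyQuantDktWindowNumerals
import HarnessLib

/-!
# QUANT lane / PAPER-2 rate track (ARM-2, gen 9): numerals asked by ARM-1 gen 9 for the Cerf-zone rows on `ℤ³`
# — the two-sided bracket `2^476 ≤ Z_3 ≤ 2^480` and the (T2) companion `θ(p) ≤ 2^541 (C+1) (p − p_c)^{2c_s/(3−c_s)}`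

builds on p205010 (kernel theorem, internal audit signed; external expert review pending)

Cell `prim-quant`, seat `prim-quant-arm-2` (constants bookkeeper), answering ARM-1 gen 9's closing asks (lane INBOX 19:06Z: "certify `Z_3`
(kernel `≤ 2^480`, true `2^478.0`)"; "the (T2) companion at `c ≈ b′/100` — `thetaHolder_Z3_of_oneArmPolyDecay_numeral` assumes `c ≤ 1/440`,
needs a variant" — the variant is ARM-2 gen 8's `thetaHolder_Z3_of_oneArmPolyDecay_numeral'`, `c ≤ 1/4`).  Proof-only numerals.

* `Quant.cerfZoneConst_three_ge` — **`2^476 ≤ Z_3`** (`Z_3 = 2^21·3^30·aknKappa 3 (1/6)`, `3^30 ≥ 2^47`, `aknKappa 3 (1/6) ≥ 2^408`, ARM-2 gen 8's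
  `aknKappa_three_sixth_ge`); with ARM-1's `cerfZoneConst_three_le` the kernel bracket is `[2^476, 2^480]` (true `2^478.0`).
* `Quant.thetaHolder_Z3_of_minTwoPoint_cerf` — for `1/64 ≤ s < 1/2` and a two-point dip `τ_{p_c}(0,v) ≤ C D^{−b}` in every ball:
  **`ThetaHolderNearCritical 3 (2c_s/(3 − c_s)) (2^541 (C+1))`**, `c_s = b′(1−2s)/(4(24+b′))`, `b′ = min(b,1)` — ARM-1's registry row
  `oneArmPolyDecayAtCritical_Z3_of_minTwoPoint_cerf` (constant `2^265√(C+1)`) through the Newman/two-box transfer; `16(2C′+125+108C′²)+2 ≤ 2^541(C+1)`.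
BOOKKEEPER'S NOTE (RATE-CONSTANTS §5.6): for the same inputs (Cerf Lemma 7.1 + `φ_{p_c} ≥ 1`) the `φ`-pair route (`…PairRouteBallCrit[Z3]`) gives the
larger exponent `b′/80` with a comparable constant (`2^265 + 2√C`), because the Harris square needs one pair's two-arms event, not the zone; this file
only completes the numerals of the zone row.  HONEST: conditional rows (open two-point input ⟺ (T1)); class log*, display `1 − 2⁻¹⁹⁸⁶`, honest
sentence UNCHANGED; the zone bracket itself is unconditional.
[cite: Cerf2015, Thm 1.2, Prop. 5.2] [cite: DuminilcopinKozmaTassion2020, Proposition 1 and §7] [cite: Newman1987BetaDelta, Theorem (β ≥ 2/δ)]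
-/

noncomputable section

namespace Summit.CriticalPhenomena.PercolationContinuityZ3.Theorems.Quant

open MeasureTheory Literature.Probability.Percolation Literature.Probability.LatticeModels
open Summit.CriticalPhenomena.PercolationContinuityZ3.Theorems.SurfaceTension
open Literature.Probability.Percolation.AKN
open scoped Classical

set_option exponentiation.threshold 1000 in
/-- **The Cerf-zone constant on `ℤ³` from below: `2^476 ≤ Z_3`** (`Z_3 = 2^21·3^30·aknKappa 3 (1/6)`; `2^21·3^30 ≥ 2^68`, `aknKappa 3 (1/6) ≥ 2^408`).
With `Quant.cerfZoneConst_three_le` (ARM-1 gen 9): `2^476 ≤ Z_3 ≤ 2^480` (true `≈ 2^478.0`). [cite: Cerf2015, Prop 5.2] -/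
theorem cerfZoneConst_three_ge :
    (2 : ℝ) ^ 476 ≤ 3 * ((3 : ℕ) : ℝ) ^ 2 * 9 ^ 3 * (16 * ((3 : ℕ) : ℝ) ^ 4) ^ 3 * (2 * ((3 : ℕ) : ℝ)) ^ (2 * 3 + 3) *
        aknKappa 3 (1 / (2 * ((3 : ℕ) : ℝ))) := by
  have h6 : (1 / (2 * ((3 : ℕ) : ℝ)) : ℝ) = 1 / 6 := by norm_num
  rw [h6]
  have hκ := aknKappa_three_sixth_ge
  have hnum : (2 : ℝ) ^ 68 ≤ 3 * ((3 : ℕ) : ℝ) ^ 2 * 9 ^ 3 * (16 * ((3 : ℕ) : ℝ) ^ 4) ^ 3 * (2 * ((3 : ℕ) : ℝ)) ^ (2 * 3 + 3) := by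
    norm_num
  calc (2 : ℝ) ^ 476 = (2 : ℝ) ^ 68 * 2 ^ 408 := by norm_num
    _ ≤ 3 * ((3 : ℕ) : ℝ) ^ 2 * 9 ^ 3 * (16 * ((3 : ℕ) : ℝ) ^ 4) ^ 3 * (2 * ((3 : ℕ) : ℝ)) ^ (2 * 3 + 3) * aknKappa 3 (1 / 6) :=
        mul_le_mul hnum hκ (by positivity) (by positivity)

set_option exponentiation.threshold 1000 in
/-- **(T2) OF THE CERF-ZONE ROW ON `ℤ³`** (asked by ARM-1 gen 9): for `1/64 ≤ s < 1/2`, a two-point dip `τ_{p_c}(0,v) ≤ C D^{−b}` at some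
`v ∈ Λ_D` for every `D ≥ 1` (`b > 0`) gives `ThetaHolderNearCritical 3 (2c_s/(3 − c_s)) (2^541 (C+1))`, `c_s = min(b,1)(1−2s)/(4(24+min(b,1)))`, i.e.
**`θ(p) ≤ 2^541 (C+1) (p − p_c)^{2c_s/(3−c_s)}`** — ARM-1's `oneArmPolyDecayAtCritical_Z3_of_minTwoPoint_cerf` (`2^265√(C+1)`, `c_s ≤ 1/96 ≤ 1/4`) through
`thetaHolder_Z3_of_oneArmPolyDecay_numeral'`.
builds on p205010 (kernel theorem, internal audit signed; external expert review pending).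
[cite: Newman1987BetaDelta, Theorem (β ≥ 2/δ)] [cite: Cerf2015, Thm 1.2] [cite: DuminilcopinKozmaTassion2020, Proposition 1 and §7] -/
theorem thetaHolder_Z3_of_minTwoPoint_cerf {b C s : ℝ} (hb0 : 0 < b) (hs : 1 / 64 ≤ s) (hs2 : s < 1 / 2)
    (hmin : ∀ D : ℕ, 1 ≤ D → ∃ v ∈ box 3 D, tau 3 (criticalProbI 3) 0 v ≤ C * (D : ℝ) ^ (-b)) :
    ThetaHolderNearCritical 3
      (2 * (min b 1 * (1 - 2 * s) / (4 * (24 + min b 1))) / (((3 : ℕ) : ℝ) - min b 1 * (1 - 2 * s) / (4 * (24 + min b 1))))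
      ((2 : ℝ) ^ 541 * (C + 1)) := by
  have h1 := oneArmPolyDecayAtCritical_Z3_of_minTwoPoint_cerf hb0 hs hs2 hmin
  have hb'0 : 0 < min b 1 := lt_min hb0 one_pos
  have hb'1 : min b 1 ≤ 1 := min_le_right _ _
  have hC0 : 0 ≤ C := by
    obtain ⟨w, -, hw⟩ := hmin 1 le_rfl
    have h := (tau_nonneg (criticalProbI 3) 0 w).trans hw
    simpa using h
  have hc0 : 0 < min b 1 * (1 - 2 * s) / (4 * (24 + min b 1)) := by
    apply div_pos (mul_pos hb'0 (by linarith)) (by positivity)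
  have hc : min b 1 * (1 - 2 * s) / (4 * (24 + min b 1)) ≤ 1 / 4 := by
    rw [div_le_div_iff₀ (by positivity) (by norm_num)]
    nlinarith
  have hC' : 0 ≤ (2 : ℝ) ^ 265 * Real.sqrt (C + 1) := by positivity
  have h2 := thetaHolder_Z3_of_oneArmPolyDecay_numeral' hc0 hc hC' h1
  refine thetaHolderNearCritical_const_mono h2 ?_
  -- `16(2C′ + 125 + 108C′²) + 2 ≤ 2^541 (C+1)` with `C′ = 2^265 √(C+1)`, `(√(C+1))² = C+1 ≥ 1`, `√(C+1) ≤ C+1`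
  set u : ℝ := C + 1 with hu
  have hu1 : 1 ≤ u := by rw [hu]; linarith
  have hsq : Real.sqrt u ^ 2 = u := Real.sq_sqrt (by linarith)
  have hsle : Real.sqrt u ≤ u := by
    have h := Real.sqrt_le_sqrt (show u ≤ u ^ 2 by nlinarith)
    rwa [Real.sqrt_sq (by linarith)] at h
  have hs0 : 0 ≤ Real.sqrt u := Real.sqrt_nonneg u
  have hexpand : 16 * (2 * ((2 : ℝ) ^ 265 * Real.sqrt u) + 125 + 108 * ((2 : ℝ) ^ 265 * Real.sqrt u) ^ 2) + 2 =
      32 * (2 : ℝ) ^ 265 * Real.sqrt u + 2002 + 1728 * (2 : ℝ) ^ 530 * u := by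
    rw [mul_pow, hsq]; norm_num; ring
  rw [hexpand]
  nlinarith [hsle, hu1, hs0]

end Summit.CriticalPhenomena.PercolationContinuityZ3.Theorems.Quant

end
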